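import Literature.AlgebraicGeometry.Resolution.GeneralizedStabilityHolds
import HarnessLib

/-!
# The generalized stability theorem over algebraically closed valued base fields: discharges (Kuhlmann 2010, §5)

Topic: `Literature/AlgebraicGeometry/Resolution` (valued function fields). F.-V. Kuhlmann,
*Elimination of ramification I: The generalized stability theorem*, Trans. Amer. Math. Soc. 362
(2010) 5697–5727 = arXiv:1003.5678, **§5** (proof of Thm. 1.1, pp. 17–20 of the arXiv version):
the statements (R2), (R3), (R4) of Lemmas 5.2–5.4 and the italicized statement of p. 19, for
rational function fields `K(t)` over an ALGEBRAICALLY CLOSED ground field `K` carrying an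
ARBITRARY valuation (not necessarily trivial), as vendored in `GeneralizedStabilityTrdegOne.lean`,
`GeneralizedStabilityFiniteRank.lean`, `GeneralizedStabilityRankOne.lean`,
`GeneralizedStabilityRankOneHenselized.lean`, `HenselizedFunctionFieldsImmediate.lean`,
`HenselizedFunctionFieldsLemma55.lean`, `NormalDegreePDefectless.lean`,
`GeneralizedStabilityRational.lean`.

With `GeneralizedStabilityHolds.lean` (Cor. 4.2: `Kuhlmann2010GaloisDegreePDefectless_holds`) the
last printed ingredient of these facts is proved; every one of them is now the composite of
PROVED reductions of this directory applied to PROVED leaves. This file records the discharges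
(no definitions, no new named facts, statements unchanged):

* `Kuhlmann2010NormalDegreePDefectless_holds` — "By Corollary 4.2 or Proposition 3.1, this
  extension is defectless" (p. 20): normal extensions of degree `p` of the fields of the class are
  defectless (`Kuhlmann2010NormalDegreePDefectless.of_galois`).
* `Kuhlmann2010NoImmediateExtensionRT_holds` — the italicized statement of p. 19 for a
  residue-transcendental generator (`Kuhlmann2010NoImmediateExtensionRT.of_parts`: Lemma 2.27 /
  the reduction to tame towers, Prop. 2.18, Cor. 4.2 / Prop. 3.1).
* `Kuhlmann2010FiniteExtensionInertiallyGenerated_holds` — Lemma 5.5 as used on p. 20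
  (`Kuhlmann2010FiniteExtensionInertiallyGenerated.of_parts`, Hensel's Lemma).
* `Kuhlmann2010StabilityHenselizedRationalResidueTranscendental_holds` — `K(x)^h` of rank one
  with a residue-transcendental generator is a defectless field
  (`Kuhlmann2010StabilityHenselizedRationalResidueTranscendental.of_ostrowski_of_galois`).
* `Kuhlmann2010StabilityRankOneResidueTranscendental_holds` — (R4) for `K(t)`, `t`
  residue-transcendental (`Kuhlmann2010StabilityRankOneResidueTranscendental.of_ostrowski_of_galois`).
* `Kuhlmann2010StabilityAlgClosedFiniteRank_holds` — (R3) for `K(t)`, `t` value-transcendental,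
  `K` algebraically closed of finite rank (`Kuhlmann2010StabilityAlgClosedFiniteRank.of_rankOne`,
  Lemma 5.4, from the two rank-one cases of (R4)).
* `Kuhlmann2010StabilityAlgClosedValueTranscendental_holds` — (R2) for `K(t)`, `t`
  value-transcendental, `K` algebraically closed with an arbitrary valuation
  (`Kuhlmann2010StabilityAlgClosedValueTranscendental.of_rankOne'`, Lemma 5.3 being
  `Kuhlmann2010AlgClosedFiniteRankReduction_holds`).
* `Kuhlmann2010StabilityValueTranscendental_holds` — Thm. 1.1 for `K(t)` with `t`
  value-transcendental over a DEFECTLESS valued field `K`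
  (`Kuhlmann2010StabilityValueTranscendental.of_descent_of_rankOne'`, Cor. 2.25 being
  `Kuhlmann2010DefectlessDescent_holds`).

These are the forms of Thm. 1.1 over non-trivially valued base fields on which the "separably
defectless" clause of Thm. 1.1 for `K(x)` over a separably closed `K` (the named facts
`Kuhlmann2010SeparablyDefectlessRational_sepClosed`,
`Kuhlmann2010SeparablyDefectlessRationalRT_sepClosed` of the decomposition of Kuhlmann 2019,
Thm. 1.3 / Knaf–Kuhlmann 2009, Thm. 3.8) rests through the passage to `K̃ = K^{1/p^∞}`
(§5, p. 20; `SeparablyDefectlessDenseDescent.lean`).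

## Sources

* F.-V. Kuhlmann, *Elimination of ramification I: The generalized stability theorem*, Trans.
  Amer. Math. Soc. 362 (2010) 5697–5727 = arXiv:1003.5678: Thm. 1.1, Cor. 2.25, §4 (Cor. 4.2),
  §5 (Lemmas 5.2–5.5 and the proof of (R4), pp. 17–20). [Kuhlmann2010]
-/

namespace Literature.AlgebraicGeometry.Resolution

universe u

/-- **DISCHARGE of `Kuhlmann2010NormalDegreePDefectless`** (Kuhlmann 2010, p. 20: "By Corollary
4.2 or Proposition 3.1, this extension is defectless" — normal extensions of degree `p` of a
finite unramified extension of a field of the class are defectless): its Galois half is Cor. 4.2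
(`Kuhlmann2010GaloisDegreePDefectless_holds`), its purely inseparable half Prop. 3.1
(`Kuhlmann2010PurelyInseparableDegreePDefectless_holds`, inside
`Kuhlmann2010NormalDegreePDefectless.of_galois`). PROVED.
[cite: Kuhlmann2010, Section 5, proof of Thm. 1.1 (p. 20), with Cor. 4.2 and Prop. 3.1] -/
theorem Kuhlmann2010NormalDegreePDefectless_holds : Kuhlmann2010NormalDegreePDefectless.{u} :=
  Kuhlmann2010NormalDegreePDefectless.of_galois Kuhlmann2010GaloisDegreePDefectless_holds

/-- **DISCHARGE of `Kuhlmann2010NoImmediateExtensionRT`** (Kuhlmann 2010, §5, the italicized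
statement of p. 19: henselized inertially generated function fields of rank one and
transcendence degree one with a residue-transcendental generator over an algebraically closed
ground field admit no proper immediate algebraic extensions), through
`Kuhlmann2010NoImmediateExtensionRT.of_parts` from the reduction to tame towers
(`Kuhlmann2010TameTowerReduction_holds`), Prop. 2.18 (`Kuhlmann2010DefectUnramifiedBaseChange_holds`)
and Cor. 4.2 / Prop. 3.1 (`Kuhlmann2010NormalDegreePDefectless_holds`). PROVED.
[cite: Kuhlmann2010, Section 5, proof of Thm. 1.1 (p. 19)] -/
theorem Kuhlmann2010NoImmediateExtensionRT_holds : Kuhlmann2010NoImmediateExtensionRT.{u} :=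
  Kuhlmann2010NoImmediateExtensionRT.of_parts Kuhlmann2010TameTowerReduction_holds
    Kuhlmann2010DefectUnramifiedBaseChange_holds Kuhlmann2010NormalDegreePDefectless_holds

/-- **DISCHARGE of `Kuhlmann2010FiniteExtensionInertiallyGenerated`** (Kuhlmann 2010, Lemma 5.5
as used on p. 20: the finite extensions occurring in the induction are again henselized
inertially generated with a residue-transcendental generator), through
`Kuhlmann2010FiniteExtensionInertiallyGenerated.of_parts` from the italicized statement
(`Kuhlmann2010NoImmediateExtensionRT_holds`) and Hensel's Lemma (`Kuhlmann2010HenselsLemma_holds`).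
PROVED. [cite: Kuhlmann2010, Lemma 5.5] -/
theorem Kuhlmann2010FiniteExtensionInertiallyGenerated_holds :
    Kuhlmann2010FiniteExtensionInertiallyGenerated.{u} :=
  Kuhlmann2010FiniteExtensionInertiallyGenerated.of_parts Kuhlmann2010NoImmediateExtensionRT_holds
    Kuhlmann2010HenselsLemma_holds

/-- **DISCHARGE of `Kuhlmann2010StabilityHenselizedRationalResidueTranscendental`** (Kuhlmann
2010, §5, pp. 18–20: the henselized rational function field `K(x)^h` of rank one with a
residue-transcendental generator over an algebraically closed `K` is a defectless field), through
`Kuhlmann2010StabilityHenselizedRationalResidueTranscendental.of_ostrowski_of_galois` from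
Ostrowski's lemma (`Kuhlmann2010OstrowskiLemma_holds`), the reduction to tame towers
(`Kuhlmann2010TameTowerReduction_holds`) and Cor. 4.2 (`Kuhlmann2010GaloisDegreePDefectless_holds`).
PROVED. [cite: Kuhlmann2010, Section 5, proof of (R4) (pp. 18–20)] -/
theorem Kuhlmann2010StabilityHenselizedRationalResidueTranscendental_holds :
    Kuhlmann2010StabilityHenselizedRationalResidueTranscendental.{u} :=
  Kuhlmann2010StabilityHenselizedRationalResidueTranscendental.of_ostrowski_of_galois
    Kuhlmann2010OstrowskiLemma_holds Kuhlmann2010TameTowerReduction_holds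
    Kuhlmann2010GaloisDegreePDefectless_holds

/-- **DISCHARGE of `Kuhlmann2010StabilityRankOneResidueTranscendental`** (Kuhlmann 2010, §5,
Lemma 5.4, (R4) for `F = K(t)` of rank one with `t̄` transcendental over `Kv`, `K` algebraically
closed: `(F, F°)` is a defectless field), through
`Kuhlmann2010StabilityRankOneResidueTranscendental.of_ostrowski_of_galois` from Ostrowski's
lemma, the reduction to tame towers and Cor. 4.2, all proved. PROVED.
[cite: Kuhlmann2010, Section 5, Lemma 5.4 (R4) and proof of (R4) (pp. 18–20)] -/
theorem Kuhlmann2010StabilityRankOneResidueTranscendental_holds :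
    Kuhlmann2010StabilityRankOneResidueTranscendental.{u} :=
  Kuhlmann2010StabilityRankOneResidueTranscendental.of_ostrowski_of_galois
    Kuhlmann2010OstrowskiLemma_holds Kuhlmann2010TameTowerReduction_holds
    Kuhlmann2010GaloisDegreePDefectless_holds

/-- **DISCHARGE of `Kuhlmann2010StabilityAlgClosedFiniteRank`** (Kuhlmann 2010, §5, Lemma 5.3,
(R3) for `F = K(t)` with `t` value-transcendental over an algebraically closed `K`, `(F, F°)` of
finite rank: `(F, F°)` is a defectless field), through
`Kuhlmann2010StabilityAlgClosedFiniteRank.of_rankOne` (Lemma 5.4: induction on the rank through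
composite valuations) from the two rank-one cases of (R4)
(`Kuhlmann2010StabilityRankOneValueTranscendental_holds`,
`Kuhlmann2010StabilityRankOneResidueTranscendental_holds`). PROVED.
[cite: Kuhlmann2010, Section 5, Lemma 5.3 (R3) and Lemma 5.4] -/
theorem Kuhlmann2010StabilityAlgClosedFiniteRank_holds :
    Kuhlmann2010StabilityAlgClosedFiniteRank.{u} :=
  Kuhlmann2010StabilityAlgClosedFiniteRank.of_rankOne
    Kuhlmann2010StabilityRankOneValueTranscendental_holds
    Kuhlmann2010StabilityRankOneResidueTranscendental_holds

/-- **DISCHARGE of `Kuhlmann2010StabilityAlgClosedValueTranscendental`** (Kuhlmann 2010, §5,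
Lemma 5.2, (R2) for `F = K(t)` with `t` value-transcendental over an algebraically closed `K`
carrying an arbitrary valuation: `(F, F°)` is a defectless field), through
`Kuhlmann2010StabilityAlgClosedValueTranscendental.of_rankOne'` (Lemma 5.3 =
`Kuhlmann2010AlgClosedFiniteRankReduction_holds`, Lemma 5.4) from the two rank-one cases of (R4).
PROVED. [cite: Kuhlmann2010, Section 5, Lemma 5.2 (R2) with Lemmas 5.3–5.4] -/
theorem Kuhlmann2010StabilityAlgClosedValueTranscendental_holds :
    Kuhlmann2010StabilityAlgClosedValueTranscendental.{u} :=
  Kuhlmann2010StabilityAlgClosedValueTranscendental.of_rankOne'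
    Kuhlmann2010StabilityRankOneValueTranscendental_holds
    Kuhlmann2010StabilityRankOneResidueTranscendental_holds

/-- **DISCHARGE of `Kuhlmann2010StabilityValueTranscendental`** (Kuhlmann 2010, Thm. 1.1 for
`F = K(t)` with `t` value-transcendental over a defectless valued field `K`: `(F, F°)` is a
defectless field), through `Kuhlmann2010StabilityValueTranscendental.of_descent_of_rankOne'`
(Lemma 5.2 via Cor. 2.25 = `Kuhlmann2010DefectlessDescent_holds`, Lemmas 5.3–5.4) from the two
rank-one cases of (R4). PROVED.
[cite: Kuhlmann2010, Thm. 1.1 and Section 5, Lemmas 5.2–5.4, Cor. 2.25] -/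
theorem Kuhlmann2010StabilityValueTranscendental_holds :
    Kuhlmann2010StabilityValueTranscendental.{u} :=
  Kuhlmann2010StabilityValueTranscendental.of_descent_of_rankOne'
    Kuhlmann2010DefectlessDescent_holds Kuhlmann2010StabilityRankOneValueTranscendental_holds
    Kuhlmann2010StabilityRankOneResidueTranscendental_holds

end Literature.AlgebraicGeometry.Resolution
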